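import Mathlib.MeasureTheory.Integral.Bochner.Basic
import Mathlib.Algebra.BigOperators.Group.Finset.Powerset
import Mathlib.Data.Set.SymmDiff
import Literature.Probability.LatticeModels.LocalParafermionicTemplate
import Summits.CriticalPhenomena.CardyFormulaZ2.Theorems.CardyComplexConeCoherentMoreraKirchhoffFlip
import HarnessLib

/-!
# Block resummation integrates to zero under `P_{1/2}`
(stub `stub_blockResummation` of line `birth`, crux `CardyDualCurrent.DualCurrentTemplateR`,
stmt-CriticalPhenomena-11201)

Let `P_{1/2} = bondPercolation (zdGraph 2) half` be Bernoulli-`1/2` bond percolation on `ℤ²`, `B` a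
finite set of edges of `ℤ²` and `F : BondConfig (Site 2) → ℂ` a `P_{1/2}`-integrable function.
If the *block resummation* `∑_{η ⊆ B} F ((ω ∖ B) ∪ η)` — the sum of `F` over the `2^|B|`
configurations of the block with the exterior `ω ∖ B` frozen — vanishes for EVERY configuration
`ω`, then `∫ F dP_{1/2} = 0` (`BlockResummation.integral_eq_zero_of_blockSum_eq_zero`, the
def-free form; `stub_blockResummation`, the registered form).

Proof: induction on `B`.  For `B = ∅` the hypothesis reads `F ω = 0`.  For `B' = insert e B`
(`e ∉ B`, `e` an edge of `ℤ²`) put `G ω = F ω + F (ω ∆ {e})`.  For `ζ = (ω ∖ B) ∪ η`, `η ⊆ B`,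
the pair `{ζ, ζ ∆ {e}}` is the pair `{(ω ∖ B') ∪ η, (ω ∖ B') ∪ insert e η}`
(`apply_add_apply_symmDiff_singleton`, `union_coe_sdiff_singleton`, `union_coe_union_singleton`),
so the block resummation of `G` over `B` is the block resummation of `F` over `B'`
(`Finset.sum_powerset_insert`) and vanishes; by induction `∫ G = 0`.  But the flip `ω ↦ ω ∆ {e}`
preserves `P_{1/2}` (`bondPercolation_half_map_toggle`, `integral_toggle_half`), so
`∫ G = ∫ F + ∫ F (· ∆ {e}) = 2 ∫ F`, whence `∫ F = 0`.

The registered signature is the NAME `Sig.stub_blockResummation` of the (non-importable) line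
skeleton `Cruxes/DualCurrentTemplateR/Lines/birth.lean` (namespace
`…Cruxes.DualCurrentTemplateR.Birth`); it is restated here verbatim-unfolded as
`Sig.stub_blockResummation` (a `def … : Prop` over Literature/Mathlib vocabulary only, asserted
nowhere, definitionally the skeleton's), next to the def-free form.
-/

noncomputable section

namespace Summit.CriticalPhenomena.CardyFormulaZ2.Theorems

open MeasureTheory Literature.Probability Literature.Probability.LatticeModels
open scoped symmDiff
open Summit.CriticalPhenomena.CardyFormulaZ2.Cruxes.CoherentMorera.FinitaryGreenPairing
  (measurable_toggle bondPercolation_half_map_toggle integral_toggle_half)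

namespace BlockResummation

/-- Pairing a configuration `ζ` with its flip `ζ ∆ {e}` at `e` is pairing "`e` closed" (`ζ \ {e}`)
with "`e` open" (`ζ ∪ {e}`). -/
theorem apply_add_apply_symmDiff_singleton {α M : Type*} [AddCommMagma M] (F : Set α → M)
    (ζ : Set α) (e : α) : F ζ + F (ζ ∆ {e}) = F (ζ \ {e}) + F (ζ ∪ {e}) := by
  by_cases he : e ∈ ζ
  · rw [symmDiff_of_ge (Set.singleton_subset_iff.2 he),
      Set.union_eq_self_of_subset_right (Set.singleton_subset_iff.2 he), add_comm]
  · rw [(Set.disjoint_singleton_right.2 he).symmDiff_eq_sup, Set.sdiff_singleton_eq_self he]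
    rfl

/-- Closing `e` in the block configuration `(ω ∖ B) ∪ η` (`e ∉ η`) freezes `e` into the exterior of
the larger block `insert e B`: `((ω ∖ B) ∪ η) ∖ {e} = (ω ∖ insert e B) ∪ η`. -/
theorem union_coe_sdiff_singleton {α : Type*} [DecidableEq α] (ω : Set α) (B η : Finset α)
    {e : α} (heη : e ∉ η) :
    ((ω \ (↑B : Set α)) ∪ (↑η : Set α)) \ {e} = (ω \ (↑(insert e B) : Set α)) ∪ (↑η : Set α) := by
  ext x
  simp only [Set.mem_sdiff, Set.mem_union, Finset.mem_coe, Set.mem_singleton_iff, Finset.coe_insert,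
    Set.mem_insert_iff]
  by_cases hx : x = e
  · subst hx
    simp [heη]
  · simp [hx]

/-- Opening `e` in the block configuration `(ω ∖ B) ∪ η` is the block configuration `insert e η` of
the larger block `insert e B`: `((ω ∖ B) ∪ η) ∪ {e} = (ω ∖ insert e B) ∪ insert e η`. -/
theorem union_coe_union_singleton {α : Type*} [DecidableEq α] (ω : Set α) (B η : Finset α)
    (e : α) :
    ((ω \ (↑B : Set α)) ∪ (↑η : Set α)) ∪ {e} =
      (ω \ (↑(insert e B) : Set α)) ∪ (↑(insert e η) : Set α) := by
  ext x
  simp only [Set.mem_sdiff, Set.mem_union, Finset.mem_coe, Set.mem_singleton_iff, Finset.coe_insert,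
    Set.mem_insert_iff]
  by_cases hx : x = e
  · subst hx
    simp
  · simp [hx]

/-- **Block resummation integrates to zero under `P_{1/2}`** (def-free form of the registered stub
`stub_blockResummation`): for a finite block `B` of edges of `ℤ²` and a `P_{1/2}`-integrable `F`, if
`∑_{η ⊆ B} F ((ω ∖ B) ∪ η) = 0` for every configuration `ω`, then `∫ F dP_{1/2} = 0` (flip
invariance of `setBer(E(ℤ²), 1/2)`, one edge of `B` at a time). -/
theorem integral_eq_zero_of_blockSum_eq_zero :
    ∀ (B : Finset MedialVertex), (↑B : Set MedialVertex) ⊆ (zdGraph 2).edgeSet →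
    ∀ (F : Percolation.BondConfig (Site 2) → ℂ),
      Integrable F (Percolation.bondPercolation (zdGraph 2) Percolation.half) →
      (∀ ω : Percolation.BondConfig (Site 2),
        ∑ η ∈ B.powerset, F ((ω \ (↑B : Set MedialVertex)) ∪ (↑η : Set MedialVertex)) = 0) →
      ∫ ω, F ω ∂(Percolation.bondPercolation (zdGraph 2) Percolation.half) = 0 := by
  classical
  intro B
  induction B using Finset.induction_on with
  | empty =>
    intro _ F _ hsum
    have hF0 : ∀ ω, F ω = 0 := fun ω => by simpa using hsum ω
    simp [hF0]
  | insert e B heB ih =>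
    intro hsub F hF hsum
    rw [Finset.coe_insert, Set.insert_subset_iff] at hsub
    obtain ⟨he, hB⟩ := hsub
    -- the flip at `e` preserves `P_{1/2}`, so the flipped integrand is integrable
    have hmp : MeasurePreserving (fun ω : Percolation.BondConfig (Site 2) => ω ∆ {e})
        (Percolation.bondPercolation (zdGraph 2) Percolation.half)
        (Percolation.bondPercolation (zdGraph 2) Percolation.half) :=
      ⟨measurable_toggle e, bondPercolation_half_map_toggle (zdGraph 2) he⟩
    have hF' : Integrable (fun ω => F (ω ∆ {e}))
        (Percolation.bondPercolation (zdGraph 2) Percolation.half) :=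
      hmp.integrable_comp_of_integrable hF
    -- the block resummation over `B` of `G ω = F ω + F (ω ∆ {e})` is that of `F` over `insert e B`
    have hG : ∫ ω, (F ω + F (ω ∆ {e})) ∂(Percolation.bondPercolation (zdGraph 2) Percolation.half)
        = 0 := by
      refine ih hB (fun ω => F ω + F (ω ∆ {e})) (hF.add hF') fun ω => ?_
      have key : ∀ η ∈ B.powerset,
          F ((ω \ (↑B : Set MedialVertex)) ∪ (↑η : Set MedialVertex)) +
              F (((ω \ (↑B : Set MedialVertex)) ∪ (↑η : Set MedialVertex)) ∆ {e}) =
            F ((ω \ (↑(insert e B) : Set MedialVertex)) ∪ (↑η : Set MedialVertex)) +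
              F ((ω \ (↑(insert e B) : Set MedialVertex)) ∪
                (↑(insert e η) : Set MedialVertex)) := by
        intro η hη
        have heη : e ∉ η := fun h => heB (Finset.mem_powerset.1 hη h)
        rw [apply_add_apply_symmDiff_singleton, union_coe_sdiff_singleton ω B η heη,
          union_coe_union_singleton ω B η e]
      rw [Finset.sum_congr rfl key, Finset.sum_add_distrib, ← Finset.sum_powerset_insert heB]
      exact hsum ω
    -- `∫ G = ∫ F + ∫ F (· ∆ {e}) = 2 ∫ F`
    rw [integral_add hF hF', integral_toggle_half (zdGraph 2) he hF.aestronglyMeasurable] at hG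
    exact add_self_eq_zero.1 hG

end BlockResummation

/-- The registered signature `Sig.stub_blockResummation` of the line skeleton
(`Cruxes/DualCurrentTemplateR/Lines/birth.lean`, namespace `…Cruxes.DualCurrentTemplateR.Birth`, not an
importable module), restated VERBATIM: for a finite block `B` of lattice edges and an integrable `F`,
if the block resummation `∑_{η ⊆ B} F ((ω ∖ B) ∪ η)` vanishes for every configuration `ω`, then
`∫ F dP_{1/2} = 0`.  A statement only — it is the type of `stub_blockResummation` below and is
asserted nowhere. -/
def Sig.stub_blockResummation : Prop :=
  ∀ (B : Finset MedialVertex), (↑B : Set MedialVertex) ⊆ (zdGraph 2).edgeSet →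
    ∀ (F : Percolation.BondConfig (Site 2) → ℂ),
      Integrable F (Percolation.bondPercolation (zdGraph 2) Percolation.half) →
      (∀ ω : Percolation.BondConfig (Site 2),
        ∑ η ∈ B.powerset, F ((ω \ (↑B : Set MedialVertex)) ∪ (↑η : Set MedialVertex)) = 0) →
      ∫ ω, F ω ∂(Percolation.bondPercolation (zdGraph 2) Percolation.half) = 0

/-- Registered stub `stub_blockResummation` (signature `Sig.stub_blockResummation`, unfolded verbatim)
of line `birth` of crux stmt-CriticalPhenomena-11201 (`CardyDualCurrent.DualCurrentTemplateR`).
**Block resummation integrates to zero under `P_{1/2}`:** for a finite block `B` of edges of `ℤ²`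
and a `P_{1/2}`-integrable `F`, if `∑_{η ⊆ B} F ((ω ∖ B) ∪ η) = 0` for every configuration `ω`,
then `∫ F dP_{1/2} = 0` (flip invariance of `setBer(E(ℤ²), 1/2)`, one edge of `B` at a time:
`BlockResummation.integral_eq_zero_of_blockSum_eq_zero`). -/
theorem stub_blockResummation : Sig.stub_blockResummation :=
  BlockResummation.integral_eq_zero_of_blockSum_eq_zero

end Summit.CriticalPhenomena.CardyFormulaZ2.Theorems

end
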